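import Mathlib
import Summits.CriticalPhenomena.CardyFormulaZ2.Theorems.CardyMagicRigidityNestingRigidityStaircasePathwise
import HarnessLib

/-!
# Crux `NestingRigidity`, line `ring-cloud-tomography` (r5): the staircase REDUCTION —
# `stub_staircaseDecoupling` (R2') from ONE remaining input (QU), both lattices

Crux `Summit.CriticalPhenomena.CardyFormulaZ2.Theses.CardyMagicRigidity.NestingRigidity`
(stmt-CriticalPhenomena-4835), line `ring-cloud-tomography`, stub R2'.  Sequel to `…StaircasePathwise`
(p121746: pathwise `A = g_tot · U_rest`, `g_tot ≥ 0`, and on the good event `G` = "no loop crosses a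
gap" the sandwich `exp(−√3Θ − Θ₂/c) ≤ U_rest ≤ exp(−√3Θ)`, `c = c_{t,k} = min (cos(t+π/3)) (cos(−t/k+π/3))`).
Here: integrability of the functional and measurability of `G` on both lattices (§1), and the assembly
(§2, registered anchor `stub_staircaseDecoupling_of_inputs`, whose conclusion is the registered stub
VERBATIM): tilted Jensen under `g_tot 1_G dP` (lower), monotonicity (upper), signed part off `G`.

**The remaining input (QU)**, per ensemble `E ∈ latticeEnsembles`, in words.  For every partner charge
`t ∈ (−5π/6, −π/2)` there are `k` with `−t/k < π/6` and a constant `C₁` (depending on `t` only) such that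
for every `ε > 0` some admissible staircase (`1 ≤ L j < M j`, `M j ≤ L l` for `j < l`) admits `C₂, r₀`
with, for all `r < r₀`, eventually as `δ → 0⁺`, writing `J = ∫ g_tot 1_G`, for SOME drift `μ ∈ ℝ`
(intended: the `g_tot 1_G`-tilted mean of `Θ`; by the first-moment identity it is
`|t| E[N_0(r,1)] + Σ_j |θ_j| E[N_j] + O(1)`, `N_j` the gap tower counts, `θ_j = t + (j+1)(−t/k)`):
(U-low) `∫ g_tot Θ 1_G ≤ μ J`, `∫ g_tot Θ₂ 1_G ≤ C₁ J` (tightness of `Σθ²`, UNIFORM in the gap widths);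
(U-up) `∫ g_tot e^{−√3Θ} 1_G ≤ C₂ e^{−√3μ} J` (tilted exponential concentration of `Θ` about its mean);
(cmp) `M_w e^{√3tm} ≤ C₂ e^{−√3μ} J ≤ C₂² M_w e^{√3tm}` (`M_w = E[w(t)^{N_0(r,1)}]`, `m = E[N_0(r,1)]`;
tower independence across scales + first-moment identity); (Q) `∫_{Gᶜ} |A| ≤ ε e^{−√3μ} J` (signed part
negligible RELATIVE TO THE MAIN TERM) — plus four integrability side conditions.  The reduction takes
`ε = e^{−C₁⁺/c_{t,k}}/4` and absorbs `C₂` and `e^{−C₁⁺/c_{t,k}}` into `r^{±η}`.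
**Why this shape** (corrects the wave-2 scratch): `C₁` must be uniform in `ε` (it fixes the Jensen
loss, hence `ε`), everything else may depend on the staircase — the tilted mean of `Θ` grows like
`Σ_j |θ_j| ν log(L (j+1)/M j)` and `J/M_w` like `∏_j E[w_j^{N_j}]` as the gaps widen, so a drift `C − t m`
or bounds in units of `M_w e^{√3tm}` with `C` fixed before `ε` are NOT satisfiable; units of
`e^{−√3μ} J` are.  And `−t/k < π/6` (not `≤ π/12`), so that few rings with large equal charges are allowed.

**DESIGN FLAG for the prover of (QU).**  Keep `w_j = w(θ_j) ≥ 1` at EVERY gap, i.e. all gap-tower phases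
`θ_j ∈ [−2π/3, 0]` (`Staircase.one_le_magicWeight_of_mem_Icc`): then `E[w_j^{N_j}] ≥ 1`, on the event
"gap `j` crossed" the gap tower is EMPTY (`towerCount_eq_zero_of_loop_cross_latticeEnsembles`,
`…StaircaseGapTowers`), and the ratio signed/main at gap `j` is `≲ P(cross j) ≤ C (M j/L (j+1))^c → 0`
(`…GapCrossing`, tilted `…GapTower`) whatever the unquantified RSW exponent `c`; with `w_j < 1` one would
need `c` to beat the decay exponent of `E[w_j^{N_j}]`.  With equal charges `−t/k` this holds iff
`t + (−t/k) ≥ −2π/3`; `k = 5` works for EVERY `t ∈ (−5π/6, −π/2)` (`−t/5 < π/6`, `4t/5 > −2π/3`), with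
`L 0 = 1` and only the four inter-ring gaps wide.  Blocks of adjacent-scale rings are NOT needed and NOT
compatible with `G` as typed (touching rings make every loop through the common circle a "crossing").
Never linearise the gap towers (log-many `O(1)` phases): `g_tot` keeps them exact, `Θ` runs over the rest.
-/

noncomputable section

open MeasureTheory Set Filter Metric
open scoped Real Topology BigOperators

namespace Summit.CriticalPhenomena.CardyFormulaZ2.Cruxes.NestingRigidity.RingCloudTomography

open Literature.Probability.RandomPlanarGeometry Literature.Probability.Percolation
  Literature.Probability.LatticeModels
open Summit.CriticalPhenomena.CardyFormulaZ2.Cruxes.NestingRigidity.PositiveConeWeightDoubling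
  (magicWeight meanTower exists_rpow_lt)

-- Local notation: the staircase cloud, its tower loops (window tower ∪ gap towers), the good event.
local notation3 "Stair(" k ", " L ", " M ", " t ", " r ")" =>
  Cloud.mk 1 k (fun _ ↦ (0 : ℂ)) (fun _ ↦ r) (fun _ ↦ t) (fun _ ↦ (0 : ℂ)) L M (fun _ ↦ -t / k)
local notation3 "Tow(" c ", " k ", " L ", " M ", " r ")" =>
  {u ∈ LoopConfig.loops c | (Metric.closedBall (0 : ℂ) r ⊆ {z | u.wind z ≠ 0} ∧ u.range ⊆ Metric.ball (0 : ℂ) 1) ∨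
    ∃ j : Fin k, (j : ℕ) + 1 < k ∧ Metric.closedBall (0 : ℂ) ((M : Fin k → ℝ) j) ⊆ {z | u.wind z ≠ 0} ∧
      ∀ l : Fin k, j < l → u.range ⊆ Metric.ball (0 : ℂ) ((L : Fin k → ℝ) l)}
local notation3 "Good(" c ", " k ", " L ", " M ")" =>
  (∀ u ∈ LoopConfig.loops c, ∀ j₁ j₂ : Fin k, j₁ < j₂ →
    ¬ ((u.range ∩ Metric.closedBall (0 : ℂ) ((M : Fin k → ℝ) j₁)).Nonempty ∧
      (u.range ∩ (Metric.ball (0 : ℂ) ((L : Fin k → ℝ) j₂))ᶜ).Nonempty))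

/-! ## §1 Integrability of the staircase functional and measurability of the good event -/

namespace Staircase

/-- **The staircase functional is integrable on both lattices** at every mesh `δ > 0`. -/
theorem integrable_nestingWeight : ∀ E ∈ latticeEnsembles, ∀ {δ : ℝ}, 0 < δ → ∀ {t r : ℝ} {k : ℕ}
    {L M : Fin k → ℝ}, 0 < k → 0 < r → (∀ j, r ≤ L j) → (∀ j, 0 < L j) → (∀ j, L j < M j) →
    (∀ j l, j < l → M j ≤ L l) → Integrable (fun ω ↦ (E.X δ ω).nestingWeight (Stair(k, L, M, t, r)).density) E.P := by
  intro E hE δ hδ t r k L M hk hr hrL hL hLM hsep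
  obtain ⟨R, hR, h0⟩ := density_data (t := t) hk hr hrL hL hLM hsep
  haveI := isProbabilityMeasure_of_mem hE
  simp only [latticeEnsembles, Set.mem_insert_iff, Set.mem_singleton_iff] at hE
  rcases hE with rfl | rfl
  · exact Integrable.mono' (integrable_const _) (measurable_nestingWeight_bondLoopConfig _ δ).aestronglyMeasurable
      (Eventually.of_forall fun ω ↦ by rw [Real.norm_eq_abs]; exact abs_nestingWeight_bondLoopConfig_le hR h0 hδ ω)
  · exact integrable_nestingWeight_siteLoopConfig hR h0 hδ (triSitePercolation half)

/-- Measurability of the good event from measurability of the gap-crossing events. -/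
theorem measurableSet_good_of {Ω : Type*} [MeasurableSpace Ω] (X : Ω → LoopConfig ℂ) (k : ℕ) (L M : Fin k → ℝ)
    (h : ∀ j₁ j₂ : Fin k, Measurable fun ω ↦ ∃ u ∈ (X ω).loops,
      (u.range ∩ Metric.closedBall (0 : ℂ) (M j₁)).Nonempty ∧ (u.range ∩ (Metric.ball (0 : ℂ) (L j₂))ᶜ).Nonempty) :
    MeasurableSet {ω | Good(X ω, k, L, M)} := by
  have key : (fun ω ↦ Good(X ω, k, L, M)) = fun ω ↦ ∀ j₁ j₂ : Fin k, j₁ < j₂ → ¬ ∃ u ∈ (X ω).loops,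
      (u.range ∩ Metric.closedBall (0 : ℂ) (M j₁)).Nonempty ∧ (u.range ∩ (Metric.ball (0 : ℂ) (L j₂))ᶜ).Nonempty := by
    funext ω
    exact propext ⟨fun h j₁ j₂ hj ⟨u, hu, hc⟩ ↦ h u hu j₁ j₂ hj hc, fun h u hu j₁ j₂ hj hc ↦ h j₁ j₂ hj ⟨u, hu, hc⟩⟩
  have hm : Measurable fun ω ↦ Good(X ω, k, L, M) := by
    rw [key]
    exact Measurable.forall fun j₁ ↦ Measurable.forall fun j₂ ↦ measurable_const.imp (h j₁ j₂).not
  exact hm.setOf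

/-- **The good event is measurable on both lattices** (each gap-crossing event is a countable union over
lattice loops of cylinder events). -/
theorem measurableSet_good : ∀ E ∈ latticeEnsembles, ∀ (δ : ℝ) (k : ℕ) (L M : Fin k → ℝ),
    MeasurableSet {ω | Good(E.X δ ω, k, L, M)} := by
  intro E hE δ k L M
  simp only [latticeEnsembles, Set.mem_insert_iff, Set.mem_singleton_iff] at hE
  rcases hE with rfl | rfl
  · refine measurableSet_good_of _ k L M fun j₁ j₂ ↦ ?_
    have e : ∀ ω : BondConfig (Site 2), (∃ u ∈ (zEns.X δ ω).loops,
        (u.range ∩ closedBall (0 : ℂ) (M j₁)).Nonempty ∧ (u.range ∩ (ball (0 : ℂ) (L j₂))ᶜ).Nonempty) ↔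
        ∃ q : {γ : List MedialVertex // γ ≠ []}, IsInterfaceLoop ω q.1 ∧
          ((UnbasedLoop.mk (BasedLoop.mk (loopCurve δ 0 q.1) (isLoop_loopCurve δ 0 q.2))).range ∩
            closedBall (0 : ℂ) (M j₁)).Nonempty ∧
          ((UnbasedLoop.mk (BasedLoop.mk (loopCurve δ 0 q.1) (isLoop_loopCurve δ 0 q.2))).range ∩
            (ball (0 : ℂ) (L j₂))ᶜ).Nonempty := fun ω ↦
      ⟨fun ⟨u, hu, h₁, h₂⟩ ↦ by obtain ⟨q, hq, rfl⟩ := (mem_loops_iff δ ω u).1 hu; exact ⟨q, hq, h₁, h₂⟩,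
        fun ⟨q, hq, h₁, h₂⟩ ↦ ⟨_, (mem_loops_iff δ ω _).2 ⟨q, hq, rfl⟩, h₁, h₂⟩⟩
    simp_rw [e]
    exact Measurable.exists fun q : {γ : List MedialVertex // γ ≠ []} ↦ (measurable_isInterfaceLoop q.1).and measurable_const
  · haveI := countable_sigma_hexLoop
    refine measurableSet_good_of _ k L M fun j₁ j₂ ↦ ?_
    have e : ∀ ω : SiteConfig (Site 2), (∃ u ∈ (tEns.X δ ω).loops,
        (u.range ∩ closedBall (0 : ℂ) (M j₁)).Nonempty ∧ (u.range ∩ (ball (0 : ℂ) (L j₂))ᶜ).Nonempty) ↔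
        ∃ q : Σ v : HexVertex, hexGraph.Walk v v, IsSiteInterfaceLoop ω q.2 ∧
          ((UnbasedLoop.mk (BasedLoop.mk (siteLoopCurve δ q.2) (isLoop_siteLoopCurve δ q.2))).range ∩
            closedBall (0 : ℂ) (M j₁)).Nonempty ∧
          ((UnbasedLoop.mk (BasedLoop.mk (siteLoopCurve δ q.2) (isLoop_siteLoopCurve δ q.2))).range ∩
            (ball (0 : ℂ) (L j₂))ᶜ).Nonempty := fun ω ↦
      ⟨fun ⟨u, hu, h₁, h₂⟩ ↦ by obtain ⟨q, hq, rfl⟩ := (mem_loops_siteLoopConfig_iff δ ω u).1 hu; exact ⟨q, hq, h₁, h₂⟩,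
        fun ⟨q, hq, h₁, h₂⟩ ↦ ⟨_, (mem_loops_siteLoopConfig_iff δ ω _).2 ⟨q, hq, rfl⟩, h₁, h₂⟩⟩
    simp_rw [e]
    exact Measurable.exists fun q : (Σ v : HexVertex, hexGraph.Walk v v) ↦
      (measurable_isSiteInterfaceLoop q.2).and measurable_const

end Staircase

/-! ## §2 THE REDUCTION: `stub_staircaseDecoupling` from the input (QU) -/

/-- The tilted tower moment is positive for every positive weight (probability law). -/
theorem towerMoment_pos_of_pos : ∀ E ∈ latticeEnsembles, ∀ {w δ : ℝ}, 0 < w → 0 < δ → ∀ r : ℝ,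
    0 < E.towerMoment w δ r := by
  intro E hE w δ hw hδ r
  haveI := isProbabilityMeasure_of_mem hE
  rw [LoopEnsemble.towerMoment, integral_pos_iff_support_of_nonneg (fun ω ↦ pow_nonneg hw.le _)
    (ConeTilt.integrable_pow_towerCount_of_nonneg E hE _ hδ 0 r 1 hw.le),
    show Function.support (fun ω ↦ w ^ towerCount (E.X δ ω) 0 r 1) = Set.univ from
      Set.eq_univ_of_forall fun ω ↦ (pow_pos hw _).ne', measure_univ]
  exact one_pos

/-- **THE REDUCTION (staircase analogue of `uvDecoupling_of_tilted_moments`).**  For `E ∈ latticeEnsembles`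
the conclusion of `stub_staircaseDecoupling` follows from the input (QU) described in the module
docstring: `k, C₁` depending on `t` only (`−t/k < π/6`), then for every `ε > 0` an admissible staircase
with constants `C₂, r₀`, and for all small `r`, eventually in `δ`, a drift `μ` with (U-low), (U-up),
(cmp), (Q) in units of `e^{−√3μ} J`, `J = ∫ g_tot 1_G`.  Proof: pathwise `A = g_tot U_rest` and
`e^{−√3Θ − Θ₂/c_{t,k}} ≤ U_rest ≤ e^{−√3Θ}` on `G` (`…StaircasePathwise`), tilted Jensen under
`g_tot 1_G dP` (`∫_G A ≥ J e^{−√3μ − C₁⁺/c_{t,k}}`), monotonicity (`∫_G A ≤ C₂ e^{−√3μ} J`), (Q) with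
`ε = e^{−C₁⁺/c_{t,k}}/4`, then (cmp) and `r^{±η}` absorb the staircase constants. -/
theorem staircaseDecoupling_of_inputs : ∀ E ∈ latticeEnsembles,
    (∀ t ∈ Set.Ioo (-(5 * π / 6)) (-(π / 2)), ∃ (k : ℕ) (C₁ : ℝ), 0 < k ∧ -t < k * (π / 6) ∧
      ∀ ε : ℝ, 0 < ε → ∃ (L M : Fin k → ℝ), (∀ j, 1 ≤ L j) ∧ (∀ j, L j < M j) ∧ (∀ j l, j < l → M j ≤ L l) ∧
        ∃ C₂ r₀ : ℝ, 0 < r₀ ∧ ∀ r ∈ Set.Ioo (0 : ℝ) r₀, ∀ᶠ δ in 𝓝[>] (0 : ℝ),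
        ∀ (gtot Θ Θ₂ : E.Ω → ℝ) (G : Set E.Ω),
          (∀ ω, gtot ω = ∏ᶠ u ∈ Tow(E.X δ ω, k, L, M, r), u.nestingFactor (Stair(k, L, M, t, r)).density) →
          (∀ ω, Θ ω = ∑ᶠ u ∈ (E.X δ ω).loops \ Tow(E.X δ ω, k, L, M, r),
            u.nestingPhase (Stair(k, L, M, t, r)).density) →
          (∀ ω, Θ₂ ω = ∑ᶠ u ∈ (E.X δ ω).loops \ Tow(E.X δ ω, k, L, M, r),
            u.nestingPhase (Stair(k, L, M, t, r)).density ^ 2) →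
          (G = {ω | Good(E.X δ ω, k, L, M)}) →
          ∃ μ : ℝ,
          Integrable (fun ω ↦ gtot ω * G.indicator 1 ω) E.P ∧
          Integrable (fun ω ↦ gtot ω * Θ ω * G.indicator 1 ω) E.P ∧
          Integrable (fun ω ↦ gtot ω * Θ₂ ω * G.indicator 1 ω) E.P ∧
          ∫ ω, gtot ω * Θ ω * G.indicator 1 ω ∂E.P ≤ μ * ∫ ω, gtot ω * G.indicator 1 ω ∂E.P ∧
          ∫ ω, gtot ω * Θ₂ ω * G.indicator 1 ω ∂E.P ≤ C₁ * ∫ ω, gtot ω * G.indicator 1 ω ∂E.P ∧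
          Integrable (fun ω ↦ gtot ω * Real.exp (-(Real.sqrt 3 * Θ ω)) * G.indicator 1 ω) E.P ∧
          ∫ ω, gtot ω * Real.exp (-(Real.sqrt 3 * Θ ω)) * G.indicator 1 ω ∂E.P ≤
            C₂ * Real.exp (-(Real.sqrt 3 * μ)) * ∫ ω, gtot ω * G.indicator 1 ω ∂E.P ∧
          E.towerMoment (magicWeight t) δ r * Real.exp (Real.sqrt 3 * t * meanTower E δ r) ≤
            C₂ * Real.exp (-(Real.sqrt 3 * μ)) * ∫ ω, gtot ω * G.indicator 1 ω ∂E.P ∧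
          Real.exp (-(Real.sqrt 3 * μ)) * ∫ ω, gtot ω * G.indicator 1 ω ∂E.P ≤
            C₂ * (E.towerMoment (magicWeight t) δ r * Real.exp (Real.sqrt 3 * t * meanTower E δ r)) ∧
          ∫ ω in Gᶜ, |(E.X δ ω).nestingWeight (Stair(k, L, M, t, r)).density| ∂E.P ≤
            ε * Real.exp (-(Real.sqrt 3 * μ)) * ∫ ω, gtot ω * G.indicator 1 ω ∂E.P) →
    ∀ t ∈ Set.Ioo (-(5 * π / 6)) (-(π / 2)), ∀ η : ℝ, 0 < η →
      ∃ (k : ℕ) (L M : Fin k → ℝ) (r₀ : ℝ), 0 < k ∧ (∀ j, 0 < L j) ∧ (∀ j, L j < M j) ∧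
        (∀ j l, j < l → M j ≤ L l) ∧ 0 < r₀ ∧ (∀ j, r₀ ≤ L j) ∧ ∀ r ∈ Set.Ioo (0 : ℝ) r₀,
          ∀ᶠ δ in 𝓝[>] (0 : ℝ),
            r ^ η * (E.towerMoment (magicWeight t) δ r * Real.exp (Real.sqrt 3 * t * meanTower E δ r)) ≤
                ∫ ω, (E.X δ ω).nestingWeight (Stair(k, L, M, t, r)).density ∂E.P ∧
              ∫ ω, (E.X δ ω).nestingWeight (Stair(k, L, M, t, r)).density ∂E.P ≤
                r ^ (-η) * (E.towerMoment (magicWeight t) δ r * Real.exp (Real.sqrt 3 * t * meanTower E δ r)) := by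
  intro E hE hIn t ht η hη
  obtain ⟨k, C₁, hk, htk, hC⟩ := hIn t ht
  -- constants depending on `(t, k, C₁)` only
  have hkpos : (0 : ℝ) < k := Nat.cast_pos.2 hk
  set C₁' : ℝ := max C₁ 0 with hC₁'
  have hC₁'0 : 0 ≤ C₁' := le_max_right _ _
  have hCC₁ : C₁ ≤ C₁' := le_max_left _ _
  set ct : ℝ := min (Real.cos (t + π / 3)) (Real.cos (-t / k + π / 3)) with hct
  have hq : -t / k < π / 6 := by rw [div_lt_iff₀ hkpos]; linarith
  have hq0 : 0 ≤ -t / k := div_nonneg (by linarith [ht.2, Real.pi_pos]) hkpos.le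
  have hct0 : 0 < ct :=
    lt_min (Real.cos_pos_of_mem_Ioo ⟨by linarith [ht.1], by linarith [ht.2, Real.pi_pos]⟩)
      (Real.cos_pos_of_mem_Ioo ⟨by linarith [Real.pi_pos], by linarith⟩)
  set K : ℝ := C₁' / ct with hK
  have hK0 : 0 ≤ K := div_nonneg hC₁'0 hct0.le
  set ε : ℝ := Real.exp (-K) / 4 with hε
  have hε0 : 0 < ε := by positivity
  obtain ⟨L, M, hL1, hLM, hsep, C₂, r₀, hr₀, hr⟩ := hC ε hε0
  -- constants depending on the staircase
  set C₂' : ℝ := max C₂ 1 with hC₂'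
  have hC₂'1 : 1 ≤ C₂' := le_max_right _ _
  have hC₂'0 : 0 < C₂' := one_pos.trans_le hC₂'1
  have hCC₂ : C₂ ≤ C₂' := le_max_left _ _
  have hL : ∀ j, 0 < L j := fun j ↦ one_pos.trans_le (hL1 j)
  have hw0 : 0 < magicWeight t :=
    mul_pos two_pos (Real.cos_pos_of_mem_Ioo ⟨by linarith [ht.1], by linarith [ht.2, Real.pi_pos]⟩)
  obtain ⟨r₃, hr₃, hsmall⟩ := exists_rpow_lt hη (lt_min (show 0 < 3 * Real.exp (-K) / (4 * C₂') by positivity)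
    (show 0 < 1 / ((C₂' + 1) * C₂') by positivity))
  refine ⟨k, L, M, min r₀ (min r₃ 1), hk, hL, hLM, hsep, lt_min hr₀ (lt_min hr₃ one_pos),
    fun j ↦ ((min_le_right _ _).trans (min_le_right _ _)).trans (hL1 j), fun r hrr ↦ ?_⟩
  have hr0 : 0 < r := hrr.1
  have hr1 : r ≤ 1 := (hrr.2.trans_le ((min_le_right _ _).trans (min_le_right _ _))).le
  have hrL : ∀ j, r ≤ L j := fun j ↦ hr1.trans (hL1 j)
  have hsm := hsmall r ⟨hr0, hrr.2.trans_le ((min_le_right _ _).trans (min_le_left _ _))⟩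
  have htI : t ∈ Set.Icc (-(5 * π / 6)) 0 := ⟨ht.1.le, by linarith [ht.2, Real.pi_pos]⟩
  filter_upwards [hr r ⟨hr0, hrr.2.trans_le (min_le_left _ _)⟩, self_mem_nhdsWithin] with δ hδ hδpos
  rw [Set.mem_Ioi] at hδpos
  haveI := isProbabilityMeasure_of_mem hE
  set f := (Stair(k, L, M, t, r)).density with hf
  set gtot : E.Ω → ℝ := fun ω ↦ ∏ᶠ u ∈ Tow(E.X δ ω, k, L, M, r), u.nestingFactor f with hgtot
  set Θ : E.Ω → ℝ := fun ω ↦ ∑ᶠ u ∈ (E.X δ ω).loops \ Tow(E.X δ ω, k, L, M, r), u.nestingPhase f with hΘ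
  set Θ₂ : E.Ω → ℝ := fun ω ↦ ∑ᶠ u ∈ (E.X δ ω).loops \ Tow(E.X δ ω, k, L, M, r), u.nestingPhase f ^ 2 with hΘ₂
  set G : Set E.Ω := {ω | Good(E.X δ ω, k, L, M)} with hGdef
  set A : E.Ω → ℝ := fun ω ↦ (E.X δ ω).nestingWeight f with hAdef
  obtain ⟨μ, hgi, hiΘ, hiΘ₂, hmΘ, hmΘ₂, hiE, hmE, hcmp, hcmp', hbad⟩ :=
    hδ gtot Θ Θ₂ G (fun _ ↦ rfl) (fun _ ↦ rfl) (fun _ ↦ rfl) rfl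
  set Mw := E.towerMoment (magicWeight t) δ r with hMw
  set em := Real.exp (Real.sqrt 3 * t * meanTower E δ r) with hem
  set Eμ := Real.exp (-(Real.sqrt 3 * μ)) with hEμ
  have hMw0 : 0 < Mw := towerMoment_pos_of_pos E hE hw0 hδpos r
  have hem0 : 0 < em := Real.exp_pos _
  have hEμ0 : 0 < Eμ := Real.exp_pos _
  -- pathwise facts
  have hg0 : ∀ ω, 0 ≤ gtot ω := fun ω ↦ Staircase.finprod_tow_nonneg htI htk.le hr0 hrL hL1 hLM hsep
  have hA : ∀ ω, A ω = gtot ω * ∏ᶠ u ∈ (E.X δ ω).loops \ Tow(E.X δ ω, k, L, M, r), u.nestingFactor f :=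
    fun ω ↦ Staircase.nestingWeight_eq_tow_mul_rest E hE hδpos ω hk hr0 hrL hL hLM hsep
  have hUV := fun ω (hω : ω ∈ G) ↦
    Staircase.finprod_rest_mem_Icc E hE hδpos ω ht.1 htI.2 hk htk hr0 hrL hL hLM hsep hω
  have hGm : MeasurableSet G := Staircase.measurableSet_good E hE δ k L M
  have hAi : Integrable A E.P := Staircase.integrable_nestingWeight E hE hδpos hk hr0 hrL hL hLM hsep
  set g' : E.Ω → ℝ := fun ω ↦ gtot ω * G.indicator 1 ω with hg'
  have hind1 : ∀ ω, ω ∈ G → G.indicator (1 : E.Ω → ℝ) ω = 1 := fun ω hω ↦ Set.indicator_of_mem hω _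
  have hind0 : ∀ ω, ω ∉ G → G.indicator (1 : E.Ω → ℝ) ω = 0 := fun ω hω ↦ Set.indicator_of_notMem hω _
  have hg'0 : ∀ ω, 0 ≤ g' ω := fun ω ↦ by
    by_cases hω : ω ∈ G
    · simp only [hg', hind1 ω hω, mul_one]; exact hg0 ω
    · simp only [hg', hind0 ω hω, mul_zero]; exact le_rfl
  have hint' : 0 ≤ ∫ ω, g' ω ∂E.P := integral_nonneg hg'0
  have hpos : 0 < ∫ ω, g' ω ∂E.P := by
    by_contra h
    have h0 : ∫ ω, g' ω ∂E.P = 0 := le_antisymm (not_lt.1 h) hint'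
    rw [h0, mul_zero] at hcmp
    exact absurd hcmp (not_le.2 (mul_pos hMw0 hem0))
  have hEJ0 : 0 ≤ Eμ * ∫ ω, g' ω ∂E.P := mul_nonneg hEμ0.le hint'
  have hlow' : Mw * em ≤ C₂' * (Eμ * ∫ ω, g' ω ∂E.P) :=
    calc Mw * em ≤ C₂ * Eμ * ∫ ω, g' ω ∂E.P := hcmp
      _ = C₂ * (Eμ * ∫ ω, g' ω ∂E.P) := mul_assoc _ _ _
      _ ≤ C₂' * (Eμ * ∫ ω, g' ω ∂E.P) := mul_le_mul_of_nonneg_right hCC₂ hEJ0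
  have hup' : Eμ * ∫ ω, g' ω ∂E.P ≤ C₂' * (Mw * em) :=
    hcmp'.trans (mul_le_mul_of_nonneg_right hCC₂ (by positivity))
  -- the split `∫ A = ∫_G A + ∫_{Gᶜ} A` and the signed part
  have hsplit : ∫ ω, A ω ∂E.P = ∫ ω in G, A ω ∂E.P + ∫ ω in Gᶜ, A ω ∂E.P := (integral_add_compl hGm hAi).symm
  have hbad' : |∫ ω in Gᶜ, A ω ∂E.P| ≤ ε * Eμ * ∫ ω, g' ω ∂E.P := (abs_integral_le_integral_abs).trans hbad
  constructor
  · -- LOWER: tilted Jensen under `g' dP` with `X = −√3 Θ − Θ₂ / c_{t,k}`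
    set X : E.Ω → ℝ := fun ω ↦ -(Real.sqrt 3 * Θ ω) - Θ₂ ω / ct with hX
    have hgX_eq : (fun ω ↦ g' ω * X ω) = fun ω ↦
        -(Real.sqrt 3) * (gtot ω * Θ ω * G.indicator 1 ω) - gtot ω * Θ₂ ω * G.indicator 1 ω / ct := by
      funext ω; simp only [hX, hg']; ring
    have hgX : Integrable (fun ω ↦ g' ω * X ω) E.P := by
      rw [hgX_eq]; exact (hiΘ.const_mul _).sub (hiΘ₂.div_const ct)
    have hintX : ∫ ω, g' ω * X ω ∂E.P = -(Real.sqrt 3) * ∫ ω, gtot ω * Θ ω * G.indicator 1 ω ∂E.P -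
        (∫ ω, gtot ω * Θ₂ ω * G.indicator 1 ω ∂E.P) / ct := by
      rw [hgX_eq, integral_sub (hiΘ.const_mul _) (hiΘ₂.div_const ct), integral_const_mul, integral_div]
    have hF : Integrable (G.indicator A) E.P := hAi.indicator hGm
    have hle : ∀ ω, g' ω * Real.exp (X ω) ≤ G.indicator A ω := fun ω ↦ by
      by_cases hω : ω ∈ G
      · rw [Set.indicator_of_mem hω, hA ω]
        simp only [hg', hind1 ω hω, mul_one]
        exact mul_le_mul_of_nonneg_left (hUV ω hω).1 (hg0 ω)
      · rw [Set.indicator_of_notMem hω]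
        simp only [hg', hind0 ω hω, mul_zero, zero_mul]; exact le_rfl
    have hJ := UVLinear.mul_exp_div_le_integral hg'0 hgi hgX hpos hF hle
    rw [integral_indicator hGm] at hJ
    have hmean : -(Real.sqrt 3 * μ) - K ≤ (∫ ω, g' ω * X ω ∂E.P) / ∫ ω, g' ω ∂E.P := by
      rw [le_div_iff₀ hpos, hintX, hK]
      have h3 : 0 < Real.sqrt 3 := Real.sqrt_pos.2 (by norm_num)
      have e1 : Real.sqrt 3 * ∫ ω, gtot ω * Θ ω * G.indicator 1 ω ∂E.P ≤
          Real.sqrt 3 * (μ * ∫ ω, g' ω ∂E.P) := mul_le_mul_of_nonneg_left hmΘ h3.le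
      have e2 : (∫ ω, gtot ω * Θ₂ ω * G.indicator 1 ω ∂E.P) / ct ≤ C₁' * (∫ ω, g' ω ∂E.P) / ct :=
        div_le_div_of_nonneg_right (hmΘ₂.trans (mul_le_mul_of_nonneg_right hCC₁ hint')) hct0.le
      have e3 : C₁' * (∫ ω, g' ω ∂E.P) / ct = C₁' / ct * ∫ ω, g' ω ∂E.P := by ring
      linarith [e1, e2, e3]
    have hlowG : (∫ ω, g' ω ∂E.P) * Real.exp (-(Real.sqrt 3 * μ) - K) ≤ ∫ ω in G, A ω ∂E.P :=
      (mul_le_mul_of_nonneg_left (Real.exp_le_exp.2 hmean) hint').trans hJ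
    have hexp : Real.exp (-(Real.sqrt 3 * μ) - K) = Eμ * Real.exp (-K) := by
      rw [hEμ, sub_eq_add_neg, Real.exp_add]
    have hrη : r ^ η ≤ 3 * Real.exp (-K) / (4 * C₂') := hsm.le.trans (min_le_left _ _)
    calc r ^ η * (Mw * em) ≤ 3 * Real.exp (-K) / (4 * C₂') * (Mw * em) :=
          mul_le_mul_of_nonneg_right hrη (by positivity)
      _ ≤ 3 * Real.exp (-K) / (4 * C₂') * (C₂' * (Eμ * ∫ ω, g' ω ∂E.P)) :=
          mul_le_mul_of_nonneg_left hlow' (by positivity)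
      _ = (∫ ω, g' ω ∂E.P) * (Eμ * Real.exp (-K)) - ε * Eμ * ∫ ω, g' ω ∂E.P := by
          rw [hε]; field_simp; ring
      _ ≤ ∫ ω in G, A ω ∂E.P + ∫ ω in Gᶜ, A ω ∂E.P := by rw [← hexp]; linarith [hlowG, (abs_le.1 hbad').1]
      _ = ∫ ω, A ω ∂E.P := hsplit.symm
  · -- UPPER: monotonicity on `G`, (Q) off `G`
    have hupG : ∫ ω in G, A ω ∂E.P ≤ ∫ ω, gtot ω * Real.exp (-(Real.sqrt 3 * Θ ω)) * G.indicator 1 ω ∂E.P := by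
      rw [← integral_indicator hGm]
      refine integral_mono (hAi.indicator hGm) hiE fun ω ↦ ?_
      by_cases hω : ω ∈ G
      · rw [Set.indicator_of_mem hω, hA ω, hind1 ω hω, mul_one]
        exact mul_le_mul_of_nonneg_left (hUV ω hω).2 (hg0 ω)
      · rw [Set.indicator_of_notMem hω, hind0 ω hω, mul_zero]
    have hε1 : ε ≤ 1 := by
      rw [hε]
      have : Real.exp (-K) ≤ 1 := Real.exp_le_one_iff.2 (neg_nonpos.2 hK0)
      linarith
    have hrη : (C₂' + 1) * C₂' ≤ r ^ (-η) := by
      rw [Real.rpow_neg hr0.le]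
      have h1 : r ^ η ≤ 1 / ((C₂' + 1) * C₂') := hsm.le.trans (min_le_right _ _)
      rw [le_inv_comm₀ (by positivity) (Real.rpow_pos_of_pos hr0 η)]
      rwa [one_div] at h1
    calc ∫ ω, A ω ∂E.P = ∫ ω in G, A ω ∂E.P + ∫ ω in Gᶜ, A ω ∂E.P := hsplit
      _ ≤ C₂ * Eμ * ∫ ω, g' ω ∂E.P + ε * Eμ * ∫ ω, g' ω ∂E.P := add_le_add (hupG.trans hmE) (abs_le.1 hbad').2
      _ ≤ C₂' * (Eμ * ∫ ω, g' ω ∂E.P) + 1 * (Eμ * ∫ ω, g' ω ∂E.P) := by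
          rw [mul_assoc, mul_assoc]
          exact add_le_add (mul_le_mul_of_nonneg_right hCC₂ hEJ0) (mul_le_mul_of_nonneg_right hε1 hEJ0)
      _ = (C₂' + 1) * (Eμ * ∫ ω, g' ω ∂E.P) := by ring
      _ ≤ (C₂' + 1) * (C₂' * (Mw * em)) := mul_le_mul_of_nonneg_left hup' (by positivity)
      _ = (C₂' + 1) * C₂' * (Mw * em) := by ring
      _ ≤ r ^ (-η) * (Mw * em) := mul_le_mul_of_nonneg_right hrη (by positivity)

/-- **Registered anchor — shape check against the registered stub**: the reduction yields
`stub_staircaseDecoupling` VERBATIM (statement text of the registered stub) from the inputs (QU) on both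
lattice ensembles (the hypothesis is that of `staircaseDecoupling_of_inputs` with the local notation expanded). -/
theorem stub_staircaseDecoupling_of_inputs :
    (∀ E ∈ latticeEnsembles, ∀ t ∈ Set.Ioo (-(5 * π / 6)) (-(π / 2)), ∃ (k : ℕ) (C₁ : ℝ), 0 < k ∧
      -t < k * (π / 6) ∧ ∀ ε : ℝ, 0 < ε → ∃ (L M : Fin k → ℝ), (∀ j, 1 ≤ L j) ∧ (∀ j, L j < M j) ∧
      (∀ j l, j < l → M j ≤ L l) ∧ ∃ C₂ r₀ : ℝ, 0 < r₀ ∧ ∀ r ∈ Set.Ioo (0 : ℝ) r₀, ∀ᶠ δ in 𝓝[>] (0 : ℝ),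
      ∀ (gtot Θ Θ₂ : E.Ω → ℝ) (G : Set E.Ω),
        (∀ ω, gtot ω = ∏ᶠ u ∈ {u ∈ (E.X δ ω).loops | (Metric.closedBall (0 : ℂ) r ⊆ {z | u.wind z ≠ 0} ∧
            u.range ⊆ Metric.ball (0 : ℂ) 1) ∨ ∃ j : Fin k, (j : ℕ) + 1 < k ∧
            Metric.closedBall (0 : ℂ) (M j) ⊆ {z | u.wind z ≠ 0} ∧ ∀ l : Fin k, j < l → u.range ⊆ Metric.ball (0 : ℂ) (L l)},
          u.nestingFactor (Cloud.mk 1 k (fun _ ↦ 0) (fun _ ↦ r) (fun _ ↦ t) (fun _ ↦ 0) L M (fun _ ↦ -t / k)).density) →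
        (∀ ω, Θ ω = ∑ᶠ u ∈ (E.X δ ω).loops \ {u ∈ (E.X δ ω).loops | (Metric.closedBall (0 : ℂ) r ⊆ {z | u.wind z ≠ 0} ∧
            u.range ⊆ Metric.ball (0 : ℂ) 1) ∨ ∃ j : Fin k, (j : ℕ) + 1 < k ∧
            Metric.closedBall (0 : ℂ) (M j) ⊆ {z | u.wind z ≠ 0} ∧ ∀ l : Fin k, j < l → u.range ⊆ Metric.ball (0 : ℂ) (L l)},
          u.nestingPhase (Cloud.mk 1 k (fun _ ↦ 0) (fun _ ↦ r) (fun _ ↦ t) (fun _ ↦ 0) L M (fun _ ↦ -t / k)).density) →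
        (∀ ω, Θ₂ ω = ∑ᶠ u ∈ (E.X δ ω).loops \ {u ∈ (E.X δ ω).loops | (Metric.closedBall (0 : ℂ) r ⊆ {z | u.wind z ≠ 0} ∧
            u.range ⊆ Metric.ball (0 : ℂ) 1) ∨ ∃ j : Fin k, (j : ℕ) + 1 < k ∧
            Metric.closedBall (0 : ℂ) (M j) ⊆ {z | u.wind z ≠ 0} ∧ ∀ l : Fin k, j < l → u.range ⊆ Metric.ball (0 : ℂ) (L l)},
          u.nestingPhase (Cloud.mk 1 k (fun _ ↦ 0) (fun _ ↦ r) (fun _ ↦ t) (fun _ ↦ 0) L M (fun _ ↦ -t / k)).density ^ 2) →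
        (G = {ω | ∀ u ∈ (E.X δ ω).loops, ∀ j₁ j₂ : Fin k, j₁ < j₂ →
          ¬ ((u.range ∩ Metric.closedBall (0 : ℂ) (M j₁)).Nonempty ∧ (u.range ∩ (Metric.ball (0 : ℂ) (L j₂))ᶜ).Nonempty)}) →
        ∃ μ : ℝ,
        Integrable (fun ω ↦ gtot ω * G.indicator 1 ω) E.P ∧
        Integrable (fun ω ↦ gtot ω * Θ ω * G.indicator 1 ω) E.P ∧
        Integrable (fun ω ↦ gtot ω * Θ₂ ω * G.indicator 1 ω) E.P ∧
        ∫ ω, gtot ω * Θ ω * G.indicator 1 ω ∂E.P ≤ μ * ∫ ω, gtot ω * G.indicator 1 ω ∂E.P ∧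
        ∫ ω, gtot ω * Θ₂ ω * G.indicator 1 ω ∂E.P ≤ C₁ * ∫ ω, gtot ω * G.indicator 1 ω ∂E.P ∧
        Integrable (fun ω ↦ gtot ω * Real.exp (-(Real.sqrt 3 * Θ ω)) * G.indicator 1 ω) E.P ∧
        ∫ ω, gtot ω * Real.exp (-(Real.sqrt 3 * Θ ω)) * G.indicator 1 ω ∂E.P ≤
          C₂ * Real.exp (-(Real.sqrt 3 * μ)) * ∫ ω, gtot ω * G.indicator 1 ω ∂E.P ∧
        E.towerMoment (magicWeight t) δ r * Real.exp (Real.sqrt 3 * t * meanTower E δ r) ≤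
          C₂ * Real.exp (-(Real.sqrt 3 * μ)) * ∫ ω, gtot ω * G.indicator 1 ω ∂E.P ∧
        Real.exp (-(Real.sqrt 3 * μ)) * ∫ ω, gtot ω * G.indicator 1 ω ∂E.P ≤
          C₂ * (E.towerMoment (magicWeight t) δ r * Real.exp (Real.sqrt 3 * t * meanTower E δ r)) ∧
        ∫ ω in Gᶜ, |(E.X δ ω).nestingWeight
            (Cloud.mk 1 k (fun _ ↦ 0) (fun _ ↦ r) (fun _ ↦ t) (fun _ ↦ 0) L M (fun _ ↦ -t / k)).density| ∂E.P ≤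
          ε * Real.exp (-(Real.sqrt 3 * μ)) * ∫ ω, gtot ω * G.indicator 1 ω ∂E.P) →
    ∀ E ∈ latticeEnsembles, ∀ t ∈ Set.Ioo (-(5 * π / 6)) (-(π / 2)), ∀ η : ℝ, 0 < η →
      ∃ (k : ℕ) (L M : Fin k → ℝ) (r₀ : ℝ), 0 < k ∧ (∀ j, 0 < L j) ∧ (∀ j, L j < M j) ∧
        (∀ j l, j < l → M j ≤ L l) ∧ 0 < r₀ ∧ (∀ j, r₀ ≤ L j) ∧ ∀ r ∈ Set.Ioo (0 : ℝ) r₀, ∀ᶠ δ in 𝓝[>] (0 : ℝ),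
          r ^ η * (E.towerMoment (magicWeight t) δ r * Real.exp (Real.sqrt 3 * t * meanTower E δ r)) ≤
              ∫ ω, (E.X δ ω).nestingWeight
                (Cloud.mk 1 k (fun _ ↦ 0) (fun _ ↦ r) (fun _ ↦ t) (fun _ ↦ 0) L M (fun _ ↦ -t / k)).density ∂E.P ∧
            ∫ ω, (E.X δ ω).nestingWeight
                (Cloud.mk 1 k (fun _ ↦ 0) (fun _ ↦ r) (fun _ ↦ t) (fun _ ↦ 0) L M (fun _ ↦ -t / k)).density ∂E.P ≤
              r ^ (-η) * (E.towerMoment (magicWeight t) δ r * Real.exp (Real.sqrt 3 * t * meanTower E δ r)) :=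
  fun hIn E hE ↦ staircaseDecoupling_of_inputs E hE (hIn E hE)

end Summit.CriticalPhenomena.CardyFormulaZ2.Cruxes.NestingRigidity.RingCloudTomography

end
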